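import Summits.ResolutionOfSingularities.ResolutionOfSingularities.Theorems.KaplanskyHensel
import HarnessLib

/-!
# KaplanskyLadder — decomp-res node «PerronLadder» (lens-1 g17 KaplanskyLadder → g18 PerronLadder), tree file
2/11 of the node

Content VERBATIM from the decomp-res lens-1 g18 file `HOME/decomp-res-lens-1/g18/PerronLadder.lean` (sha256
8bb02ceefe11b749, 3725 l; it SUPERSEDES
g17 `KaplanskyLadder.lean` fb35e2e5 ⊇ g16 `ToricLadder.lean` 67376591 as landing source; PARTS I–III = the
landed `Theorems/ToricLadderCells`,
`ToricLadderKernels`, `ToricLadderLinks`, `ToricLadderDense`, `ToricLadder` — not repeated).  HOME =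
run/shared/lean/pub/decomp-res.  Critic:
CRITIC-LEDGER rows 131 (g17, 2026-08-30T18:47:14Z) and 138 (g18 CLEARED, landing order 2026-08-30T20:05:14Z); the
lens's WRITER.md (endorsed).
Landed by decomp-res writer g7 as SUPPORT of the Valuative route item 0641 `LuAlphaPTorsor` (helper files; no
Valuative route edit is made by the
decomp-res cell: the support ports Σ₁ `MonoidalStep` / Π₁ `KK05NCVAscent`, the retirement of g16's all-rank
`ToricAscent 3` in favour of the theorem
`toricAscentRk1_three`, and the UNCHANGED located residual `NonKHToricArchLU 3 3 4` / port-free `NonKHArchLU 3 4`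
stay documented tree definitions
for the Valuative tenure / operator to book).

PART IV (g17) §15 the Kaplansky ladder: cell, residuals (`NonKHToricArchLU`, port-free `NonKHArchLU`), EXACT cuts,
the decided cell `c ≤ 3`,
root and host links BY NAME.

[WRITER NOTE (decomp-res writer g7): namespaces `…Theses.PerronLadder` ↦ `…Theorems.KaplanskyLadder` (PART IV
= g17 §14–§16, files
`KaplanskyLadder`, `KaplanskyLadderDefectless`) and ↦ `…Theorems.PerronLadder` (PART V, files `PerronMerge`
§17, `PerronCharts` §18–§19,
`PerronMonomialization` §20, `PerronInitialChartPrelim` + `PerronInitialChart` §21 (400-line limit),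
`PerronRepresentations` §22, `PerronAscent`
§23, `PerronLadder` §24; PART IV likewise `KaplanskyHensel` §14 / `KaplanskyLadder` §15), with `open
…Theorems.ToricLadder` (+ `…KaplanskyLadder`) so the lens's unqualified references stay verbatim; `section PartV` and its
section-scoped `open`s re-opened per file; the g16 helper `intermediateField_top_fg` is the landed
`PfaffLine.intermediateField_top_fg_of_isFractionRing`
(renamed at its use, as in the landed `ToricLadder`); global `set_option` lines dropped; nothing else changed.]

(Sources: CossartPiltant2019; CossartJannsenSaito2020; KnafKuhlmann2005 arXiv:math/0304159 §4 Thm 4.1, Lemmas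
4.2–4.4; KnafKuhlmann2009 arXiv:math/0702856 Prop 3.11, Thm 1.5; Kaplansky1942 Lemma 5, Thm 3; Kuhlmann2010 Thm
2.14; Zariski1940 §B; Cutkosky arXiv:1404.7459 §2.1; ZariskiSamuelII.)
-/

noncomputable section

open IsLocalRing Literature.AlgebraicGeometry.Resolution
open Summit.ResolutionOfSingularities.ResolutionOfSingularities.Theses
open Summit.ResolutionOfSingularities.ResolutionOfSingularities.Theorems
open Summit.ResolutionOfSingularities.ResolutionOfSingularities.Theorems.PfaffLine
open Summit.ResolutionOfSingularities.ResolutionOfSingularities.Theorems.ToricLadder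

namespace Summit.ResolutionOfSingularities.ResolutionOfSingularities.Theorems.KaplanskyLadder

/-! ## 15. The Kaplansky ladder: cell, residuals, exact cuts, the decided cell `c ≤ 3`, root and host links -/

/-- CELL (DECIDED for `c ≤ 3` modulo the floor alone: `khLU_three`): valuation rings of function fields of
transcendence degree `≤ n` admitting a Kaplansky–Hensel top over a finitely generated subfield of
transcendence degree `≤ c`. -/
def KaplanskyHenselLU (c n : ℕ) : Prop :=
  ∀ p : ℕ, p.Prime → ∀ (k K : Type) [Field k] [CharP k p] [Field K] [Algebra k K],
    Algebra.trdeg k K ≤ n → ∀ O : ValuationSubring K, KHTopBelow k O c →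
    RelLocalUniformization k K O

/-- RESIDUAL PIECE, port-free ladder (tag UNDECIDED · WEAKER than the root · located residual at
`(c, n) = (3, 4)`): the gen-15 residual OFF THE KAPLANSKY–HENSEL LOCUS — rank-one, zero-dimensional,
non-Abhyankar valuation rings of function fields of transcendence degree `≤ n`, not separably dense over any
finitely generated subfield of transcendence degree `< n`, and admitting NO Kaplansky–Hensel top over a
finitely generated subfield of transcendence degree `≤ c` (over every such subfield the top is non-immediate,
or of algebraic type — a limit key polynomial / Artin–Schreier defect limit — or has a non-étale finite part). -/
def NonKHArchLU (c n : ℕ) : Prop :=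
  ∀ p : ℕ, p.Prime → ∀ (k K : Type) [Field k] [CharP k p] [Field K] [Algebra k K],
    Algebra.trdeg k K ≤ n → ∀ O : ValuationSubring K, Nonempty O.valuation.RankOne →
    (∀ y ∈ O, ∃ f : Polynomial k, f ≠ 0 ∧ Polynomial.aeval y f ∈ O.nonunits) →
    ¬ IsAbhyankarPlace O (algebraMap k K).fieldRange ⊤ →
    ¬ (∃ d : ℕ, d < n ∧ SepDenseBelow k O d) → ¬ KHTopBelow k O c →
    RelLocalUniformization k K O

/-- RESIDUAL PIECE of THIS GENERATION'S TARGET (tag UNDECIDED · WEAKER than the root · located residual at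
`(e, c, n) = (2, 3, 4)`, true residual `(3, 3, 4)`): the gen-16 residual `NonToricArchLU e n` OFF THE
KAPLANSKY–HENSEL LOCUS with base bound `c`. -/
def NonKHToricArchLU (e c n : ℕ) : Prop :=
  ∀ p : ℕ, p.Prime → ∀ (k K : Type) [Field k] [CharP k p] [Field K] [Algebra k K],
    Algebra.trdeg k K ≤ n → ∀ O : ValuationSubring K, Nonempty O.valuation.RankOne →
    (∀ y ∈ O, ∃ f : Polynomial k, f ≠ 0 ∧ Polynomial.aeval y f ∈ O.nonunits) →
    ¬ IsAbhyankarPlace O (algebraMap k K).fieldRange ⊤ →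
    ¬ (∃ d : ℕ, d < n ∧ SepDenseBelow k O d) → ¬ ToricDenseBelow k O e → ¬ KHTopBelow k O c →
    RelLocalUniformization k K O

/-- `khLU_of_luRel'`: Auxiliary step of this node's calculus, VERBATIM from the lens file (see the module
docstring); the statement is its type. [folklore] -/
theorem khLU_of_luRel' {c n : ℕ} (h : LURel n) : KaplanskyHenselLU c n :=
  fun p hp k K _ _ _ _ hd O _ => h p hp k K hd O

/-- `nonKHArchLU_of_nonSepDenseNonAbh`: Auxiliary step of this node's calculus, VERBATIM from the lens file (see the
module docstring); the statement is its type. [folklore] -/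
theorem nonKHArchLU_of_nonSepDenseNonAbh {c n : ℕ} (h : NonSepDenseNonAbhArchLU n) : NonKHArchLU c n :=
  fun p hp k K _ _ _ _ hd O h1 h0 hA hnd _ => h p hp k K hd O h1 h0 hA hnd

/-- `nonKHToricArchLU_of_nonToric`: Auxiliary step of this node's calculus, VERBATIM from the lens file (see the
module docstring); the statement is its type. [folklore] -/
theorem nonKHToricArchLU_of_nonToric {e c n : ℕ} (h : NonToricArchLU e n) : NonKHToricArchLU e c n :=
  fun p hp k K _ _ _ _ hd O h1 h0 hA hnd hnt _ => h p hp k K hd O h1 h0 hA hnd hnt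

/-- `nonKHToricArchLU_of_nonKH`: Auxiliary step of this node's calculus, VERBATIM from the lens file (see the module
docstring); the statement is its type. [folklore] -/
theorem nonKHToricArchLU_of_nonKH {e c n : ℕ} (h : NonKHArchLU c n) : NonKHToricArchLU e c n :=
  fun p hp k K _ _ _ _ hd O h1 h0 hA hnd _ hnk => h p hp k K hd O h1 h0 hA hnd hnk

/-- `nonKHArchLU_of_luRel`: Auxiliary step of this node's calculus, VERBATIM from the lens file (see the module
docstring); the statement is its type. [folklore] -/
theorem nonKHArchLU_of_luRel {c n : ℕ} (h : LURel n) : NonKHArchLU c n :=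
  nonKHArchLU_of_nonSepDenseNonAbh ((nonSepDenseArchLU_iff_nonAbh n).1 (nonSepDenseArchLU_of_luRel h))

/-- `nonKHToricArchLU_of_luRel`: Auxiliary step of this node's calculus, VERBATIM from the lens file (see the module
docstring); the statement is its type. [folklore] -/
theorem nonKHToricArchLU_of_luRel {e c n : ℕ} (h : LURel n) : NonKHToricArchLU e c n :=
  nonKHToricArchLU_of_nonToric (nonToricArchLU_of_luRel h)

/-- Raising the base bound shrinks the residuals. [folklore] -/
theorem nonKHArchLU_mono {c c' n : ℕ} (hcc : c ≤ c') (h : NonKHArchLU c n) : NonKHArchLU c' n :=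
  fun p hp k K _ _ _ _ hd O h1 h0 hA hnd hnk =>
    h p hp k K hd O h1 h0 hA hnd (fun hD => hnk (khTopBelow_mono O hcc hD))

/-- `nonKHToricArchLU_mono`: Auxiliary step of this node's calculus, VERBATIM from the lens file (see the module
docstring); the statement is its type. [folklore] -/
theorem nonKHToricArchLU_mono {e e' c c' n : ℕ} (hee : e ≤ e') (hcc : c ≤ c')
    (h : NonKHToricArchLU e c n) : NonKHToricArchLU e' c' n :=
  fun p hp k K _ _ _ _ hd O h1 h0 hA hnd hnt hnk =>
    h p hp k K hd O h1 h0 hA hnd (fun hD => hnt (toricDenseBelow_mono O hee hD))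
      (fun hD => hnk (khTopBelow_mono O hcc hD))

/-- **K16 · THE KAPLANSKY–HENSEL LAW ON THE LADDER (port-free).**  Rung `c` decides the Kaplansky–Hensel
cell with base bound `c` at EVERY rung `n`. [folklore] -/
theorem khLU_of_luRel {c : ℕ} (hL : LURel c) (n : ℕ) : KaplanskyHenselLU c n := by
  intro p hp k K _ _ _ _ hn O hD
  exact relLU_of_khTopBelow O (fun F₁ _ htr => hL p hp k F₁ htr (O.comap (algebraMap F₁ K))) hD

/-- **NEW CELL, DECIDED-MOD-FLOOR (Cossart–Piltant 2019 ALONE; no port)**: at EVERY rung `n`, every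
valuation of a function field of transcendence degree `≤ n` in characteristic `p` (any ground field) that is
a Kaplansky–Hensel top over a finitely generated subfield of transcendence degree `≤ 3` admits relative
local uniformization. [folklore] -/
theorem khLU_three (hCP : CossartPiltant2019LU3.{0}) (n : ℕ) : KaplanskyHenselLU 3 n :=
  khLU_of_luRel (luRel_three_of_cp hCP) n

/-- `khLU_of_le_three`: Auxiliary step of this node's calculus, VERBATIM from the lens file (see the module
docstring); the statement is its type. [folklore] -/
theorem khLU_of_le_three (hCP : CossartPiltant2019LU3.{0}) {c : ℕ} (hc : c ≤ 3) (n : ℕ) :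
    KaplanskyHenselLU c n :=
  khLU_of_luRel (luRel_of_le_three hCP hc) n

/-- **K17 · THE KAPLANSKY–HENSEL CUT of the gen-15 residual** (excluded middle on the datum). [folklore] -/
theorem nonSepDenseNonAbh_of_kh_cut {c n : ℕ} (hL : LURel c) (hN : NonKHArchLU c n) :
    NonSepDenseNonAbhArchLU n := by
  intro p hp k K _ _ _ _ hn O hr hzd hA hnd
  by_cases hD : KHTopBelow k O c
  · exact khLU_of_luRel hL n p hp k K hn O hD
  · exact hN p hp k K hn O hr hzd hA hnd hD

/-- **EXACT** (port-free): given rung `c`, the gen-15 residual IS its non-Kaplansky–Hensel part. [folklore] -/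
theorem nonSepDenseNonAbh_iff_nonKH {c : ℕ} (hL : LURel c) (n : ℕ) :
    NonSepDenseNonAbhArchLU n ↔ NonKHArchLU c n :=
  ⟨nonKHArchLU_of_nonSepDenseNonAbh, nonSepDenseNonAbh_of_kh_cut hL⟩

/-- **K18 · THE KAPLANSKY–HENSEL CUT of the gen-16 residual** (this generation's TARGET; needs NO toric
ascent — the cell is decided by rung `c` alone). [folklore] -/
theorem nonToric_of_kh_cut {e c n : ℕ} (hL : LURel c) (hN : NonKHToricArchLU e c n) :
    NonToricArchLU e n := by
  intro p hp k K _ _ _ _ hn O hr hzd hA hnd hnt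
  by_cases hD : KHTopBelow k O c
  · exact khLU_of_luRel hL n p hp k K hn O hD
  · exact hN p hp k K hn O hr hzd hA hnd hnt hD

/-- **EXACT**: given rung `c`, the gen-16 residual IS its non-Kaplansky–Hensel part. [folklore] -/
theorem nonToric_iff_nonKHToric {c : ℕ} (hL : LURel c) (e n : ℕ) :
    NonToricArchLU e n ↔ NonKHToricArchLU e c n :=
  ⟨nonKHToricArchLU_of_nonToric, nonToric_of_kh_cut hL⟩

/-- **THIS GENERATION'S TARGET, CUT EXACTLY modulo the floor ALONE**:
`NonToricArchLU 2 4 ↔ NonKHToricArchLU 2 3 4` (and the same for every toric base bound `e`). [folklore] -/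
theorem nonToric_two_four_iff_nonKH (hCP : CossartPiltant2019LU3.{0}) (e : ℕ) :
    NonToricArchLU e 4 ↔ NonKHToricArchLU e 3 4 :=
  nonToric_iff_nonKHToric (luRel_three_of_cp hCP) e 4

/-- **THE LOCATED RESIDUAL, REFINED PORT-FREE**: rung 4 is exactly the non-Kaplansky–Hensel (base bound 3)
part of the gen-15 residual, modulo the Cossart–Piltant floor. [folklore] -/
theorem luRel_four_iff_nonKH (hCP : CossartPiltant2019LU3.{0}) : LURel 4 ↔ NonKHArchLU 3 4 :=
  (luRel_four_iff_nonAbh_four hCP).trans (nonSepDenseNonAbh_iff_nonKH (luRel_three_of_cp hCP) 4)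

/-- With the gen-16 printed port (toric ascent over surface bases): rung 4 is exactly the part of the gen-16
located residual off the Kaplansky–Hensel locus. [folklore] -/
theorem luRel_four_iff_nonKHToric (hCP : CossartPiltant2019LU3.{0}) (hP : ToricAscent 2) :
    LURel 4 ↔ NonKHToricArchLU 2 3 4 :=
  (luRel_four_iff_nonToric_two hCP hP).trans (nonToric_two_four_iff_nonKH hCP 2)

/-- The two residual gradings commute: off the Kaplansky–Hensel locus, the toric cut of gen 16 is still exact. [folklore] -/
theorem nonKH_iff_nonKHToric {e c : ℕ} (hT : ToricAscent e) (hLe : LURel e) (n : ℕ) :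
    NonKHArchLU c n ↔ NonKHToricArchLU e c n := by
  refine ⟨nonKHToricArchLU_of_nonKH, fun h => ?_⟩
  intro p hp k K _ _ _ _ hn O hr hzd hA hnd hnk
  by_cases hD : ToricDenseBelow k O e
  · exact toricDenseLU_of_toricAscent hT hLe n p hp k K hn O hD
  · exact h p hp k K hn O hr hzd hA hnd hD hnk

/-- **`closes_kaplansky` — ROOT BY NAME, PORT-FREE (deciding theorem of this node).**  Cossart–Piltant floor
(print) + the non-Kaplansky–Hensel residuals in transcendence degree `≥ 4` + the route's patching crux 0642
⇒ `ResolutionOfSingularities`. [folklore] -/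
theorem closes_kaplansky (hCP : CossartPiltant2019LU3.{0}) (hN : ∀ d, 4 ≤ d → NonKHArchLU 3 d)
    (h₃ : Valuative.PatchingRel) : _root_.ResolutionOfSingularities :=
  closes_final hCP (fun d hd => nonSepDenseNonAbh_of_kh_cut (luRel_three_of_cp hCP) (hN d hd)) h₃

/-- The same through the route's own deciding theorem `Valuative.closes`. [folklore] -/
theorem closes_kaplansky' (hCP : CossartPiltant2019LU3.{0}) (hN : ∀ d, 4 ≤ d → NonKHArchLU 3 d)
    (h₄ : Valuative.TorsorToLurel) (h₃ : Valuative.PatchingRel) : _root_.ResolutionOfSingularities :=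
  Valuative.closes
    (luAlphaPTorsor_of_nonSepDense hCP (fun d hd => (nonSepDenseArchLU_iff_nonAbh d).2
      (nonSepDenseNonAbh_of_kh_cut (luRel_three_of_cp hCP) (hN d hd)))) h₄ h₃

/-- ROOT BY NAME along the full three-cut ladder (density · toric · Kaplansky–Hensel): floor + the gen-16
port + the residuals `NonKHToricArchLU 2 3 d`, `d ≥ 4`, + patching. [folklore] -/
theorem closes_kaplansky_toric (hCP : CossartPiltant2019LU3.{0}) (hP : ToricAscent 2)
    (hN : ∀ d, 4 ≤ d → NonKHToricArchLU 2 3 d) (h₃ : Valuative.PatchingRel) :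
    _root_.ResolutionOfSingularities :=
  closes_toric hCP hP (fun d hd => nonToric_of_kh_cut (luRel_three_of_cp hCP) (hN d hd)) h₃

/-- **WEAKER (kernel): the cell and both residuals are consequences of the ROOT.** [folklore] -/
theorem khLU_of_root (hS : _root_.ResolutionOfSingularities) (c n : ℕ) : KaplanskyHenselLU c n :=
  khLU_of_luRel' (luRel_of_root hS n)

/-- `nonKHArchLU_of_root`: Auxiliary step of this node's calculus, VERBATIM from the lens file (see the module
docstring); the statement is its type. [folklore] -/
theorem nonKHArchLU_of_root (hS : _root_.ResolutionOfSingularities) (c n : ℕ) : NonKHArchLU c n :=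
  nonKHArchLU_of_luRel (luRel_of_root hS n)

/-- `nonKHToricArchLU_of_root`: Auxiliary step of this node's calculus, VERBATIM from the lens file (see the module
docstring); the statement is its type. [folklore] -/
theorem nonKHToricArchLU_of_root (hS : _root_.ResolutionOfSingularities) (e c n : ℕ) :
    NonKHToricArchLU e c n :=
  nonKHToricArchLU_of_luRel (luRel_of_root hS n)

/-- **WEAKER than the host's cone.** [folklore] -/
theorem khLU_of_hostCone (h₂ : Valuative.LuAlphaPTorsor) (h₄ : Valuative.TorsorToLurel) (c n : ℕ) :
    KaplanskyHenselLU c n :=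
  khLU_of_luRel' (luRel_of_hostCone h₂ h₄ n)

/-- `nonKHArchLU_of_hostCone`: Auxiliary step of this node's calculus, VERBATIM from the lens file (see the module
docstring); the statement is its type. [folklore] -/
theorem nonKHArchLU_of_hostCone (h₂ : Valuative.LuAlphaPTorsor) (h₄ : Valuative.TorsorToLurel) (c n : ℕ) :
    NonKHArchLU c n :=
  nonKHArchLU_of_luRel (luRel_of_hostCone h₂ h₄ n)

/-- `nonKHToricArchLU_of_hostCone`: Auxiliary step of this node's calculus, VERBATIM from the lens file (see the
module docstring); the statement is its type. [folklore] -/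
theorem nonKHToricArchLU_of_hostCone (h₂ : Valuative.LuAlphaPTorsor) (h₄ : Valuative.TorsorToLurel)
    (e c n : ℕ) : NonKHToricArchLU e c n :=
  nonKHToricArchLU_of_luRel (luRel_of_hostCone h₂ h₄ n)

/-- Summary (root-level, port-free): `ResolutionOfSingularities` is equivalent, modulo the Cossart–Piltant
floor and the route's patching crux, to the NON-KAPLANSKY–HENSEL residuals in transcendence degree `≥ 4`. [folklore] -/
theorem root_iff_nonKH (hCP : CossartPiltant2019LU3.{0}) (h₃ : Valuative.PatchingRel) :
    _root_.ResolutionOfSingularities ↔ ∀ d, 4 ≤ d → NonKHArchLU 3 d :=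
  ⟨fun hS d _ => nonKHArchLU_of_root hS 3 d, fun hN => closes_kaplansky hCP hN h₃⟩

/-- Summary (root-level, full ladder). [folklore] -/
theorem root_iff_nonKHToric (hCP : CossartPiltant2019LU3.{0}) (hP : ToricAscent 2)
    (h₃ : Valuative.PatchingRel) :
    _root_.ResolutionOfSingularities ↔ ∀ d, 4 ≤ d → NonKHToricArchLU 2 3 d :=
  ⟨fun hS d _ => nonKHToricArchLU_of_root hS 2 3 d, fun hN => closes_kaplansky_toric hCP hP hN h₃⟩

/-- Summary (residual-level, port-free): the gen-15 residual splits, modulo the floor, as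
`(∀ d ≥ 4, NonSepDenseNonAbhArchLU d) ↔ (∀ d ≥ 4, NonKHArchLU 3 d)`. [folklore] -/
theorem nonSepDenseNonAbh_iff_nonKH_all (hCP : CossartPiltant2019LU3.{0}) :
    (∀ d, 4 ≤ d → NonSepDenseNonAbhArchLU d) ↔ ∀ d, 4 ≤ d → NonKHArchLU 3 d :=
  ⟨fun hA d hd => nonKHArchLU_of_nonSepDenseNonAbh (hA d hd),
    fun hN d hd => nonSepDenseNonAbh_of_kh_cut (luRel_three_of_cp hCP) (hN d hd)⟩

end Summit.ResolutionOfSingularities.ResolutionOfSingularities.Theorems.KaplanskyLadder
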